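import Mathlib.LinearAlgebra.Quotient.Basic
import Mathlib.Algebra.Exact.Basic
import Mathlib.Tactic.Group
import Mathlib.LinearAlgebra.Span.Basic
import Mathlib.Algebra.BigOperators.Group.Finset.Basic
import Mathlib.Algebra.Module.LinearMap.End
import Mathlib.Algebra.Module.BigOperators
import Mathlib.Data.Fintype.BigOperators
import HarnessLib

/-!
# `χ`-coinvariants of an exact four-term sequence under a finite group: a COMPLEX, exact at the two right-hand
# terms, whose left-hand defects are killed by the group order — generic algebra (any commutative ring)

Cell `bsd-print-cf2`, width seat `bsd-line-cf2c-w6` g2 (AUTOFILL #2 PART 2 item (3)), brick §4(d) of the LEAD memo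
`Cruxes/SplitBadTwoRankOneOfFacts/RULING-B23-g13.md` for crux `PrintCf2RubinValueTwo.TwoVariableMainConjAtSplitTwo`
(stmt-BirchSwinnertonDyer-23720, S3a), part II (c). Rubin's exact sequence (5)
`0 → ℰ_∞/𝒞_∞ → U_∞/𝒞_∞ → X_∞ → A_∞ → 0` is a sequence of `Λ = ℤ_p⟦𝒢⟧`-modules, `𝒢 = Δ × Γ`; for `p ∤ #Δ` the
`χ`-parts are exact functors (Rubin 1991 §4 p. 36–37, §6 p. 43), but the crux sits at `p = 2` with `2 ∣ #Δ′`, where the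
tree's objects are `χ`-COINVARIANTS (`SemilocalUnitData₂.Coinv χ = M ⧸ ⟨υ·m − χ(υ)m⟩`, LTYZ 2025 §2.2 `M_χ`; the
`Λ₂`-duals `DualData₂.X`, `ClassGroupDualData₂.X`) or `χ`-EIGEN classes (`UnitIndexData₂.Q`). This file is the
homological bookkeeping of that passage, for ANY commutative ring `R`, finite group `Υ` acting `R`-linearly
(`ρ : Υ →* Module.End R M`) and `χ : Υ →* ℤˣ` (the shape of `SemilocalUnitData₂.coinvRel`: relations
`ρ υ m − χ(υ)·m`, `χ(υ) = ±1` read in `ℤ`):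

* §1 the `χ`-norm `N_χ m = ∑_τ χ(τ)⁻¹·τm`: `N_χ(υm) = χ(υ)N_χ m`, `υ(N_χ m) = χ(υ)N_χ m`, `N_χ` kills the
  `χ`-relations, and `N_χ m ≡ #Υ·m` modulo the `χ`-relations;
* §2 eigen ↔ coinvariants: a `χ`-eigenvector lying in the `χ`-relations is killed by `#Υ`
  (`card_smul_eq_zero_of_eigen_of_mem_span`), and `#Υ·m` is a `χ`-eigenvector modulo the relations
  (`exists_eigen_card_smul_sub_mem_span`) — kernel and cokernel of `M^χ → M_χ` are killed by `#Υ`;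
* §3 equivariant maps: relations map to relations (`span_rel_le_comap`), ONTO for a surjection
  (`map_span_rel_eq_of_surjective`), and the Tor-defect `f q ∈ rel(P) ⟹ #Υ·q ∈ rel(M) + ker f`;
* §4 the four-term sequence: for `0 → E → U → X → A → 0` exact and equivariant, the induced maps of `χ`-coinvariants
  (`Submodule.mapQ`) satisfy: `X_χ → A_χ` surjective, **exact at `X_χ`** (`exact_mapQ_of_exact_of_surjective`),
  `U_χ → X_χ ∘ E_χ → U_χ = 0`, **`#Υ · ker(U_χ → X_χ) ⊆ range(E_χ → U_χ)`**
  (`card_smul_mem_range_mapQ_of_mapQ_eq_zero`) and **`#Υ · ker(E_χ → U_χ) = 0`**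
  (`card_smul_eq_zero_of_mapQ_eq_zero`).
So at `p ∣ #Υ` the coinvariant sequence is a complex with defects killed by `#Υ` (hence by a power of `p` times a
unit), which the companion files `…FourTermPseudoNull` / `…TwoVariableMCOfBricksPseudoNull` consume once the defects
are known to be pseudo-null (`μ`-type input). NO definitions: the relation module is written out as
`Submodule.span R {y | ∃ υ m, y = ρ υ m − ((χ υ : ℤˣ) : ℤ) • m}` throughout.

THEOREMS ONLY (no `def`, no named fact, no `sorry`); Mathlib-only imports; nothing about any curve or field;
`--supports` the crux as a helper. BSD is not proved by any of this; no summit statement is proved here.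

References: K. Rubin, Invent. Math. 103 (1991), §4 pp. 36–37 ((5), `Y^χ`), §6 p. 43 [Rubin1991]; Li–Tian–Yan–Zhu 2025,
§2.2 (`M_χ`), Thm. 7.2 [LiTianYanZhu2025]; K. S. Brown, *Cohomology of Groups*, III §1 / VI §5 (norm element,
`Ĥ`-groups killed by the group order) — standard.
-/

set_option linter.dupNamespace false -- D-0017: single-problem summit, `…BirchSwinnertonDyer.BirchSwinnertonDyer…` repeats a namespace by design
set_option autoImplicit false

namespace Summit.BirchSwinnertonDyer.BirchSwinnertonDyer.Theorems.PrintCf2.Coinvariant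

universe u₁ u₂ u₃ u₄

variable {R : Type*} [CommRing R] {Υ : Type*} [Group Υ] [Fintype Υ] (χ : Υ →* ℤˣ)
  {M : Type u₁} [AddCommGroup M] [Module R M] (ρ : Υ →* Module.End R M)

/-! ## §1. The `χ`-norm `N_χ m = ∑_τ χ(τ)⁻¹ · τ m` -/

omit [Fintype Υ] in
/-- `τ(υ m) = (τυ) m` for a representation `ρ : Υ →* End_R(M)`. [folklore] -/
theorem act_act (τ υ : Υ) (m : M) : ρ τ (ρ υ m) = ρ (τ * υ) m := by
  rw [map_mul, Module.End.mul_apply]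

/-- **`N_χ(υ m) = χ(υ) · N_χ m`**: the `χ`-norm transforms the action into the character (reindex `τ ↦ τυ`).
[folklore] -/
theorem norm_act (υ : Υ) (m : M) :
    ∑ τ : Υ, (((χ τ)⁻¹ : ℤˣ) : ℤ) • ρ τ (ρ υ m) =
      ((χ υ : ℤˣ) : ℤ) • ∑ τ : Υ, (((χ τ)⁻¹ : ℤˣ) : ℤ) • ρ τ m := by
  simp_rw [act_act ρ]
  rw [Finset.smul_sum]
  refine Fintype.sum_equiv (Equiv.mulRight υ) _ _ fun τ ↦ ?_
  simp only [Equiv.coe_mulRight, ← mul_smul, ← Units.val_mul]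
  congr 2
  rw [map_mul]
  group

/-- **`υ(N_χ m) = χ(υ) · N_χ m`**: the `χ`-norm of any element is a `χ`-eigenvector (reindex `τ ↦ υτ`).
[folklore] -/
theorem act_norm (υ : Υ) (m : M) :
    ρ υ (∑ τ : Υ, (((χ τ)⁻¹ : ℤˣ) : ℤ) • ρ τ m) =
      ((χ υ : ℤˣ) : ℤ) • ∑ τ : Υ, (((χ τ)⁻¹ : ℤˣ) : ℤ) • ρ τ m := by
  rw [map_sum, Finset.smul_sum]
  simp_rw [map_zsmul, act_act ρ]
  refine Fintype.sum_equiv (Equiv.mulLeft υ) _ _ fun τ ↦ ?_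
  simp only [Equiv.coe_mulLeft, ← mul_smul, ← Units.val_mul]
  congr 2
  rw [map_mul, mul_comm (χ υ) (χ τ)]
  group

/-- The `χ`-norm kills the `χ`-relation `υ m − χ(υ) m`. [folklore] -/
theorem norm_rel_eq_zero (υ : Υ) (m : M) :
    ∑ τ : Υ, (((χ τ)⁻¹ : ℤˣ) : ℤ) • ρ τ (ρ υ m - ((χ υ : ℤˣ) : ℤ) • m) = 0 := by
  simp_rw [map_sub, map_zsmul, smul_sub, Finset.sum_sub_distrib, norm_act χ ρ]
  rw [sub_eq_zero, Finset.smul_sum]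
  exact Finset.sum_congr rfl fun τ _ ↦ smul_comm _ _ _

/-- **The `χ`-norm kills the whole `χ`-relation module** `⟨υ m − χ(υ) m⟩_R` (it is `R`-linear and kills the
generators). [folklore] -/
theorem norm_eq_zero_of_mem_span {y : M}
    (hy : y ∈ Submodule.span R {y | ∃ (υ : Υ) (m : M), y = ρ υ m - ((χ υ : ℤˣ) : ℤ) • m}) :
    ∑ τ : Υ, (((χ τ)⁻¹ : ℤˣ) : ℤ) • ρ τ y = 0 := by
  -- the norm as an `R`-linear endomorphism
  let S : Module.End R M := ∑ τ : Υ, (((χ τ)⁻¹ : ℤˣ) : ℤ) • ρ τ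
  have hS : ∀ m : M, S m = ∑ τ : Υ, (((χ τ)⁻¹ : ℤˣ) : ℤ) • ρ τ m := fun m ↦ by
    simp only [S, LinearMap.sum_apply, LinearMap.smul_apply]
  have hle : Submodule.span R {y | ∃ (υ : Υ) (m : M), y = ρ υ m - ((χ υ : ℤˣ) : ℤ) • m} ≤
      LinearMap.ker S := by
    refine Submodule.span_le.mpr ?_
    rintro _ ⟨υ, m, rfl⟩
    rw [SetLike.mem_coe, LinearMap.mem_ker, hS]
    exact norm_rel_eq_zero χ ρ υ m
  rw [← hS]
  exact LinearMap.mem_ker.mp (hle hy)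

/-- **`N_χ m ≡ #Υ · m` modulo the `χ`-relations**: `N_χ m − #Υ·m = ∑_τ χ(τ)⁻¹(τ m − χ(τ) m)` (as `χ(τ)⁻¹χ(τ) = 1`).
[folklore] -/
theorem norm_sub_card_smul_mem_span (m : M) :
    (∑ τ : Υ, (((χ τ)⁻¹ : ℤˣ) : ℤ) • ρ τ m) - (Fintype.card Υ : ℤ) • m ∈
      Submodule.span R {y | ∃ (υ : Υ) (m : M), y = ρ υ m - ((χ υ : ℤˣ) : ℤ) • m} := by
  have hcard : (Fintype.card Υ : ℤ) • m = ∑ _τ : Υ, m := by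
    rw [Finset.sum_const, Finset.card_univ, ← natCast_zsmul]
  rw [hcard, ← Finset.sum_sub_distrib]
  refine Submodule.sum_mem _ fun τ _ ↦ ?_
  have hτ : (((χ τ)⁻¹ : ℤˣ) : ℤ) • ρ τ m - m =
      (((χ τ)⁻¹ : ℤˣ) : ℤ) • (ρ τ m - ((χ τ : ℤˣ) : ℤ) • m) := by
    rw [smul_sub, ← mul_smul, ← Units.val_mul, inv_mul_cancel, Units.val_one, one_smul]
  rw [hτ]
  exact Submodule.smul_of_tower_mem _ _ (Submodule.subset_span ⟨τ, m, rfl⟩)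

/-! ## §2. `χ`-eigenvectors versus `χ`-coinvariants -/

/-- **Kernel of `M^χ → M_χ` is killed by `#Υ`**: a `χ`-eigenvector lying in the `χ`-relation module is killed by
`#Υ` (its `χ`-norm is `#Υ` times itself and vanishes). [folklore] -/
theorem card_smul_eq_zero_of_eigen_of_mem_span {m : M} (heig : ∀ υ : Υ, ρ υ m = ((χ υ : ℤˣ) : ℤ) • m)
    (hm : m ∈ Submodule.span R {y | ∃ (υ : Υ) (m : M), y = ρ υ m - ((χ υ : ℤˣ) : ℤ) • m}) :
    (Fintype.card Υ : ℤ) • m = 0 := by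
  have h := norm_eq_zero_of_mem_span χ ρ hm
  simp_rw [heig, ← mul_smul, ← Units.val_mul, inv_mul_cancel, Units.val_one, one_smul, Finset.sum_const,
    Finset.card_univ, ← natCast_zsmul] at h
  exact h

/-- **Cokernel of `M^χ → M_χ` is killed by `#Υ`**: for every `m` there is a `χ`-eigenvector `e` (namely `N_χ m`)
with `#Υ·m ≡ e` modulo the `χ`-relations. [folklore] -/
theorem exists_eigen_card_smul_sub_mem_span (m : M) :
    ∃ e : M, (∀ υ : Υ, ρ υ e = ((χ υ : ℤˣ) : ℤ) • e) ∧
      (Fintype.card Υ : ℤ) • m - e ∈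
        Submodule.span R {y | ∃ (υ : Υ) (m : M), y = ρ υ m - ((χ υ : ℤˣ) : ℤ) • m} := by
  refine ⟨∑ τ : Υ, (((χ τ)⁻¹ : ℤˣ) : ℤ) • ρ τ m, fun υ ↦ act_norm χ ρ υ m, ?_⟩
  rw [← neg_sub]
  exact Submodule.neg_mem _ (norm_sub_card_smul_mem_span χ ρ m)

/-! ## §3. Equivariant maps -/

section Maps

variable {P : Type u₂} [AddCommGroup P] [Module R P] (ρP : Υ →* Module.End R P) (f : M →ₗ[R] P)

omit [Fintype Υ] in
/-- Relations map to relations: for an equivariant `f`, `rel_χ(M) ≤ f⁻¹ rel_χ(P)` — the compatibility making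
`Submodule.mapQ` (the induced map `M_χ → P_χ`) well defined. [folklore] -/
theorem span_rel_le_comap (hf : ∀ (υ : Υ) (m : M), f (ρ υ m) = ρP υ (f m)) :
    Submodule.span R {y | ∃ (υ : Υ) (m : M), y = ρ υ m - ((χ υ : ℤˣ) : ℤ) • m} ≤
      (Submodule.span R {y | ∃ (υ : Υ) (q : P), y = ρP υ q - ((χ υ : ℤˣ) : ℤ) • q}).comap f := by
  refine Submodule.span_le.mpr ?_
  rintro _ ⟨υ, m, rfl⟩
  rw [SetLike.mem_coe, Submodule.mem_comap, map_sub, map_zsmul, hf]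
  exact Submodule.subset_span ⟨υ, f m, rfl⟩

omit [Fintype Υ] in
/-- For an equivariant SURJECTION the relations of `P` are exactly the images of the relations of `M`
(`f(rel_χ(M)) = rel_χ(P)`): right exactness of `χ`-coinvariants. [folklore] -/
theorem map_span_rel_eq_of_surjective (hf : ∀ (υ : Υ) (m : M), f (ρ υ m) = ρP υ (f m))
    (hfs : Function.Surjective f) :
    (Submodule.span R {y | ∃ (υ : Υ) (m : M), y = ρ υ m - ((χ υ : ℤˣ) : ℤ) • m}).map f =
      Submodule.span R {y | ∃ (υ : Υ) (q : P), y = ρP υ q - ((χ υ : ℤˣ) : ℤ) • q} := by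
  refine le_antisymm (Submodule.map_le_iff_le_comap.mpr (span_rel_le_comap χ ρ ρP f hf)) ?_
  refine Submodule.span_le.mpr ?_
  rintro _ ⟨υ, q, rfl⟩
  obtain ⟨m, rfl⟩ := hfs q
  exact ⟨ρ υ m - ((χ υ : ℤˣ) : ℤ) • m, Submodule.subset_span ⟨υ, m, rfl⟩, by rw [map_sub, map_zsmul, hf]⟩

/-- **The Tor-defect is killed by `#Υ`**: if `f q` lies in the `χ`-relations of `P` then `#Υ·q` lies in the
`χ`-relations of `M` plus `ker f` (`N_χ q ∈ ker f` by equivariance, and `N_χ q ≡ #Υ·q`). For `f` injective: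
`#Υ · ker(M_χ → P_χ) = 0`. [folklore] -/
theorem card_smul_mem_span_sup_ker_of_map_mem_span (hf : ∀ (υ : Υ) (m : M), f (ρ υ m) = ρP υ (f m))
    {q : M} (hq : f q ∈ Submodule.span R {y | ∃ (υ : Υ) (q : P), y = ρP υ q - ((χ υ : ℤˣ) : ℤ) • q}) :
    (Fintype.card Υ : ℤ) • q ∈
      Submodule.span R {y | ∃ (υ : Υ) (m : M), y = ρ υ m - ((χ υ : ℤˣ) : ℤ) • m} ⊔ LinearMap.ker f := by
  have hN : ∑ τ : Υ, (((χ τ)⁻¹ : ℤˣ) : ℤ) • ρ τ q ∈ LinearMap.ker f := by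
    rw [LinearMap.mem_ker, map_sum]
    simp_rw [map_zsmul, hf]
    exact norm_eq_zero_of_mem_span χ ρP hq
  have h := Submodule.add_mem_sup (Submodule.neg_mem _ (norm_sub_card_smul_mem_span χ ρ q)) hN
  rwa [neg_sub, sub_add_cancel] at h

end Maps

/-! ## §4. The four-term sequence -/

section FourTerm

variable {E : Type u₁} [AddCommGroup E] [Module R E] {U : Type u₂} [AddCommGroup U] [Module R U]
  {X : Type u₃} [AddCommGroup X] [Module R X] {A : Type u₄} [AddCommGroup A] [Module R A]
  (ρE : Υ →* Module.End R E) (ρU : Υ →* Module.End R U) (ρX : Υ →* Module.End R X)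
  (ρA : Υ →* Module.End R A)

omit [Fintype Υ] in
/-- The induced map of `χ`-coinvariants of a surjection is surjective. [folklore] -/
theorem mapQ_surjective_of_surjective (π : X →ₗ[R] A) (hπ : ∀ (υ : Υ) (x : X), π (ρX υ x) = ρA υ (π x))
    (hπs : Function.Surjective π) :
    Function.Surjective (Submodule.mapQ _ _ π (span_rel_le_comap χ ρX ρA π hπ)) := by
  intro a
  obtain ⟨a, rfl⟩ := Submodule.mkQ_surjective _ a
  obtain ⟨x, rfl⟩ := hπs a
  exact ⟨Submodule.Quotient.mk x, by simp [Submodule.mapQ_apply]⟩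

omit [Fintype Υ] in
/-- Composites stay zero: if `range u ≤ ker π` then the induced maps of `χ`-coinvariants compose to zero
(`range ū ≤ ker π̄`). [folklore] -/
theorem range_mapQ_le_ker_mapQ (u : U →ₗ[R] X) (π : X →ₗ[R] A)
    (hu : ∀ (υ : Υ) (y : U), u (ρU υ y) = ρX υ (u y)) (hπ : ∀ (υ : Υ) (x : X), π (ρX υ x) = ρA υ (π x))
    (huπ : LinearMap.range u ≤ LinearMap.ker π) :
    LinearMap.range (Submodule.mapQ _ _ u (span_rel_le_comap χ ρU ρX u hu)) ≤
      LinearMap.ker (Submodule.mapQ _ _ π (span_rel_le_comap χ ρX ρA π hπ)) := by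
  rintro _ ⟨y, rfl⟩
  obtain ⟨y, rfl⟩ := Submodule.mkQ_surjective _ y
  rw [LinearMap.mem_ker, Submodule.mkQ_apply, Submodule.mapQ_apply, Submodule.mapQ_apply,
    show π (u y) = 0 from LinearMap.mem_ker.mp (huπ ⟨y, rfl⟩), Submodule.Quotient.mk_zero]

omit [Fintype Υ] in
/-- **`χ`-coinvariants are exact at `X_χ`**: for `U → X → A → 0` exact and equivariant with `X → A` surjective, the
induced `U_χ → X_χ → A_χ` is exact (right exactness: a class mapping into the relations of `A` differs from an
element of the relations of `X` by an element of `ker π = range u`). [folklore] -/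
theorem exact_mapQ_of_exact_of_surjective (u : U →ₗ[R] X) (π : X →ₗ[R] A)
    (hu : ∀ (υ : Υ) (y : U), u (ρU υ y) = ρX υ (u y)) (hπ : ∀ (υ : Υ) (x : X), π (ρX υ x) = ρA υ (π x))
    (hexact : Function.Exact u π) (hπs : Function.Surjective π) :
    Function.Exact (Submodule.mapQ _ _ u (span_rel_le_comap χ ρU ρX u hu))
      (Submodule.mapQ _ _ π (span_rel_le_comap χ ρX ρA π hπ)) := by
  refine LinearMap.exact_iff.mpr (le_antisymm ?_ (range_mapQ_le_ker_mapQ χ ρU ρX ρA u π hu hπ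
    (LinearMap.exact_iff.mp hexact).ge))
  intro x hx
  obtain ⟨x, rfl⟩ := Submodule.mkQ_surjective _ x
  rw [LinearMap.mem_ker, Submodule.mkQ_apply, Submodule.mapQ_apply, Submodule.Quotient.mk_eq_zero,
    ← map_span_rel_eq_of_surjective χ ρX ρA π hπ hπs] at hx
  obtain ⟨x', hx', hxx'⟩ := hx
  have hker : x - x' ∈ LinearMap.range u := by
    rw [← hexact.linearMap_ker_eq, LinearMap.mem_ker, map_sub, hxx', sub_self]
  obtain ⟨y, hy⟩ := hker
  refine ⟨Submodule.Quotient.mk y, ?_⟩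
  rw [Submodule.mapQ_apply, hy, Submodule.mkQ_apply, ← sub_eq_zero, ← Submodule.Quotient.mk_sub,
    sub_sub_cancel_left, Submodule.Quotient.mk_eq_zero]
  exact Submodule.neg_mem _ hx'

/-- **`#Υ · ker(U_χ → X_χ) ⊆ range(E_χ → U_χ)`** for `E → U → X` exact (at `U`) and equivariant: if `ū ȳ = 0` then
`#Υ·ȳ` is in the image of `E_χ`. (For `y ∈ U` with `u y` in the relations of `X`: `N_χ y ∈ ker u = range ι` by
equivariance, and `N_χ y ≡ #Υ·y` modulo the relations of `U`.) [folklore] -/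
theorem card_smul_mem_range_mapQ_of_mapQ_eq_zero (ι : E →ₗ[R] U) (u : U →ₗ[R] X)
    (hι : ∀ (υ : Υ) (e : E), ι (ρE υ e) = ρU υ (ι e)) (hu : ∀ (υ : Υ) (y : U), u (ρU υ y) = ρX υ (u y))
    (hexact : Function.Exact ι u) {y : U ⧸ Submodule.span R {z | ∃ (υ : Υ) (m : U), z = ρU υ m - ((χ υ : ℤˣ) : ℤ) • m}}
    (hy : Submodule.mapQ _ _ u (span_rel_le_comap χ ρU ρX u hu) y = 0) :
    (Fintype.card Υ : ℤ) • y ∈ LinearMap.range (Submodule.mapQ _ _ ι (span_rel_le_comap χ ρE ρU ι hι)) := by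
  obtain ⟨y, rfl⟩ := Submodule.mkQ_surjective _ y
  rw [Submodule.mkQ_apply, Submodule.mapQ_apply, Submodule.Quotient.mk_eq_zero] at hy
  have h := card_smul_mem_span_sup_ker_of_map_mem_span χ ρU ρX u hu hy
  rw [hexact.linearMap_ker_eq] at h
  obtain ⟨w, hw, _, ⟨e, rfl⟩, hwe⟩ := Submodule.mem_sup.mp h
  refine ⟨Submodule.Quotient.mk e, ?_⟩
  have hw0 : (Submodule.span R {z | ∃ (υ : Υ) (m : U), z = ρU υ m - ((χ υ : ℤˣ) : ℤ) • m}).mkQ w = 0 :=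
    (Submodule.Quotient.mk_eq_zero _).mpr hw
  rw [Submodule.mapQ_apply, ← map_zsmul, ← hwe, map_add, hw0, zero_add, Submodule.mkQ_apply]

/-- **`#Υ · ker(E_χ → U_χ) = 0`** for `ι : E ↪ U` injective and equivariant: a class of `E_χ` dying in `U_χ` is
killed by `#Υ`. [folklore] -/
theorem card_smul_eq_zero_of_mapQ_eq_zero (ι : E →ₗ[R] U) (hι : ∀ (υ : Υ) (e : E), ι (ρE υ e) = ρU υ (ι e))
    (hinj : Function.Injective ι)
    {e : E ⧸ Submodule.span R {z | ∃ (υ : Υ) (m : E), z = ρE υ m - ((χ υ : ℤˣ) : ℤ) • m}}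
    (he : Submodule.mapQ _ _ ι (span_rel_le_comap χ ρE ρU ι hι) e = 0) :
    (Fintype.card Υ : ℤ) • e = 0 := by
  obtain ⟨e, rfl⟩ := Submodule.mkQ_surjective _ e
  rw [Submodule.mkQ_apply, Submodule.mapQ_apply, Submodule.Quotient.mk_eq_zero] at he
  have h := card_smul_mem_span_sup_ker_of_map_mem_span χ ρE ρU ι hι he
  rw [LinearMap.ker_eq_bot.mpr hinj, sup_bot_eq] at h
  rw [← map_zsmul, Submodule.mkQ_apply, Submodule.Quotient.mk_eq_zero]
  exact h

end FourTerm

end Summit.BirchSwinnertonDyer.BirchSwinnertonDyer.Theorems.PrintCf2.Coinvariant
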